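import Summits.Ventures.LatticeQCDFlow.Scaling.ParallelTemperingWithinReplica
import Summits.Ventures.LatticeQCDFlow.Scaling.ParallelTemperingAlgorithm

/-!
HONEST FRAMING: exact (Metropolis-corrected) sampling algorithms for lattice gauge theory; figures
of merit are autocorrelation/cost numbers at stated couplings and volumes; no continuum-physics
claim.

# ParallelTemperingReversibleSampler — A FULLY CONSTRUCTED REVERSIBLE REPLICA-EXCHANGE SAMPLER: RESAMPLING A
# REPLICA BY A REVERSIBLE KERNEL IS REVERSIBLE FOR THE PRODUCT; THE UNIFORM RANDOM-REPLICA UPDATE; HENCE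
# `τ_int(tag) ≥ e·m·(b−a)²/48 − ½` FOR `t·ptSwapKernel + (1−t)·ptRandomUpdate M` (lean-2 GEN-14, ours)

Venture-side (OURS).  Cell `lqcd-flow` (pub-lqcd), unit `pub-lqcd-lean-2-g14`, 2026-08-24.  The `τ_int` floor of
`Scaling/ParallelTemperingAlgorithm.ptMix_level_tauInt_ge_kfree` asks the within-replica dynamics `M` to be
REVERSIBLE for the tagged target; the deterministic sweep `ptSweep` of `Scaling/ParallelTemperingWithinReplica` is
invariant but not reversible.  Here: (§1) `coordUpdateKernel k M_k` is `⊗_jμ_j`-REVERSIBLE when `M_k` is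
`μ_k`-reversible (Fubini over the `piFinSuccAbove` decomposition: the update acts on the `k`-th factor only);
(§2) so is its tagged lift `ptReplicaUpdate`; (§3) the UNIFORM MIXTURE of finitely many kernels
(`uniformMixtureKernel`) preserves Markov / invariance / reversibility / tag preservation; (§4) the random-replica
update `ptRandomUpdate M = (K+1)⁻¹Σ_k ptReplicaUpdate k (M k)` is therefore a tag-preserving, `ptTaggedTarget`-
invariant, and — for reversible `M_k` — reversible Markov kernel, and the random-scan replica-exchange sampler
`t·ptSwapKernel + (1−t)·ptRandomUpdate M` obeys the replica-number-free `τ_int` law with every ingredient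
constructed.

## What is proved

* §1 **`isReversible_coordUpdateKernel`** (Mathlib's `Fin.update_insertNth` identifies the `B`-section).
* §2 `setLIntegral_ptTaggedTarget_level`, **`isReversible_ptReplicaUpdate`**.
* §3 `uniformMixtureMeasure`, **`uniformMixtureKernel κ`** (`= (n+1)⁻¹Σ_i κ_i` on `Fin (n+1)`), `…_apply'`,
  `IsMarkovKernel`, `invariant_uniformMixtureKernel`, `isReversible_uniformMixtureKernel`, `uniformMixtureKernel_null`.
* §4 **`ptRandomUpdate M`**: Markov, `ptRandomUpdate_tagPreserving`, **`invariant_ptRandomUpdate`**,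
  **`isReversible_ptRandomUpdate`**; **`ptRandom_level_tauInt_ge_kfree`** — uniform ladder on `[a,b]`, floor
  `0 < m ≤ Var_{μ_u}(X)`, every `M_k` `μ_{β_k}`-reversible Markov, `K ≥ 1`, every `t`, summable tag
  autocorrelations with `ρ(1) < 1`: `e·m·(b−a)²/48 − ½ ≤ τ_int(tag)` for `t·ptSwapKernel + (1−t)·ptRandomUpdate M`.

NOT CLAIMED: irreducibility; the summability provisos; any measured number.  Literature grade (cell rule):
TEXTBOOK (random-scan hybrid kernels, Tierney 1994), NEW TYPING; nothing cited as a fact.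
-/

noncomputable section

open MeasureTheory ProbabilityTheory Set Filter Finset
open Summit.Ventures.LatticeQCDFlow.Scoring
open scoped ENNReal

namespace Summit.Ventures.LatticeQCDFlow.Scaling

/-! ## §1 Resampling one coordinate by a reversible kernel is reversible for the product -/

section Coord

variable {Ω : Type*} [MeasurableSpace Ω] {K : ℕ}

variable (k : Fin (K + 1)) (Mk : Kernel Ω Ω) [IsMarkovKernel Mk]

/-- **RESAMPLING ONE COORDINATE BY A REVERSIBLE KERNEL IS REVERSIBLE FOR THE PRODUCT**: if `M_k` is
`μs k`-reversible, `coordUpdateKernel k M_k` is `Measure.pi μs`-reversible (probability factors). [ours] -/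
theorem isReversible_coordUpdateKernel (μs : Fin (K + 1) → Measure Ω) [∀ i, IsProbabilityMeasure (μs i)]
    (hMk : Kernel.IsReversible Mk (μs k)) : Kernel.IsReversible (coordUpdateKernel k Mk) (Measure.pi μs) := by
  set e := MeasurableEquiv.piFinSuccAbove (fun _ : Fin (K + 1) => Ω) k with he_def
  set ν : Measure (Fin K → Ω) := Measure.pi fun j => μs (k.succAbove j) with hν
  have he : MeasurePreserving e.symm ((μs k).prod ν) (Measure.pi μs) := (measurePreserving_piFinSuccAbove μs k).symm
  have hx : ∀ (a : Ω) (r : Fin K → Ω),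
      e.symm (a, r) = Fin.insertNth (α := fun _ : Fin (K + 1) => Ω) k a r := fun a r => by
    funext j; rw [he_def, MeasurableEquiv.piFinSuccAbove_symm_apply, Fin.insertNthEquiv_apply]
  -- the two-set functional in the coordinates `(a, r)`: sections at `r`
  have key : ∀ {A B : Set (Fin (K + 1) → Ω)}, MeasurableSet A → MeasurableSet B →
      ∫⁻ x in A, coordUpdateKernel k Mk x B ∂(Measure.pi μs) =
        ∫⁻ r, ∫⁻ a in {a | e.symm (a, r) ∈ A}, Mk a {y | e.symm (y, r) ∈ B} ∂(μs k) ∂ν := by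
    intro A B hA hB
    have hAm : MeasurableSet {p : Ω × (Fin K → Ω) | e.symm p ∈ A} := e.symm.measurable hA
    have hBm : MeasurableSet {p : Ω × (Fin K → Ω) | e.symm p ∈ B} := e.symm.measurable hB
    -- the integrand and its measurability on `Ω × (Fin K → Ω)`
    have hT : MeasurableSet {q : (Ω × (Fin K → Ω)) × Ω | e.symm (q.2, q.1.2) ∈ B} :=
      e.symm.measurable.comp (measurable_snd.prodMk (measurable_snd.comp measurable_fst)) hB
    have hsec : Measurable fun p : Ω × (Fin K → Ω) => Mk p.1 {y | e.symm (y, p.2) ∈ B} := by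
      have h := Kernel.measurable_kernel_prodMk_left (κ := Mk.comap (Prod.fst : Ω × (Fin K → Ω) → Ω) measurable_fst) hT
      simpa [Kernel.comap_apply] using h
    have hF : Measurable fun p : Ω × (Fin K → Ω) =>
        {p : Ω × (Fin K → Ω) | e.symm p ∈ A}.indicator 1 p * Mk p.1 {y | e.symm (y, p.2) ∈ B} :=
      (measurable_one.indicator hAm).mul hsec
    rw [← lintegral_indicator hA, ← he.lintegral_comp (((coordUpdateKernel k Mk).measurable_coe hB).indicator hA)]
    have hpt : ∀ p : Ω × (Fin K → Ω), A.indicator (fun x => coordUpdateKernel k Mk x B) (e.symm p) =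
        {p : Ω × (Fin K → Ω) | e.symm p ∈ A}.indicator 1 p * Mk p.1 {y | e.symm (y, p.2) ∈ B} := by
      rintro ⟨a, r⟩
      by_cases hz : e.symm (a, r) ∈ A
      · rw [Set.indicator_of_mem hz, Set.indicator_of_mem (show (a, r) ∈ {p : Ω × (Fin K → Ω) | e.symm p ∈ A} from hz),
          Pi.one_apply, one_mul, coordUpdateKernel_apply' k Mk _ hB]
        have hxk : e.symm (a, r) k = a := by rw [hx, Fin.insertNth_apply_same]
        rw [hxk]
        congr 1
        ext y
        simp only [Set.mem_preimage, Set.mem_setOf_eq, hx]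
        rw [Fin.update_insertNth]
      · rw [Set.indicator_of_notMem hz,
          Set.indicator_of_notMem (show (a, r) ∉ {p : Ω × (Fin K → Ω) | e.symm p ∈ A} from hz), zero_mul]
    simp only [hpt]
    rw [lintegral_prod_symm _ hF.aemeasurable]
    refine lintegral_congr fun r => ?_
    rw [← lintegral_indicator (show MeasurableSet {a : Ω | e.symm (a, r) ∈ A} from measurable_prodMk_right hAm)]
    refine lintegral_congr fun a => ?_
    by_cases h : e.symm (a, r) ∈ A
    · rw [Set.indicator_of_mem (show (a, r) ∈ {p : Ω × (Fin K → Ω) | e.symm p ∈ A} from h),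
        Set.indicator_of_mem (show a ∈ {a | e.symm (a, r) ∈ A} from h), Pi.one_apply, one_mul]
    · rw [Set.indicator_of_notMem (show (a, r) ∉ {p : Ω × (Fin K → Ω) | e.symm p ∈ A} from h),
        Set.indicator_of_notMem (show a ∉ {a | e.symm (a, r) ∈ A} from h), zero_mul]
  intro A B hA hB
  rw [key hA hB, key hB hA]
  refine lintegral_congr fun r => ?_
  exact hMk (measurable_prodMk_right (e.symm.measurable hA)) (measurable_prodMk_right (e.symm.measurable hB))

end Coord

/-! ## §2 The tagged lift is reversible -/

section Tagged

variable {Ω : Type*} [MeasurableSpace Ω] {X : Ω → ℝ} {μ : Measure Ω} {β : ℕ → ℝ} {K : ℕ}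

/-- Set integrals against the tagged target, tag by tag:
`∫⁻_A f dπ = (K+1)⁻¹·Σ_τ ∫⁻_{x : (τ,x) ∈ A} f(τ,x) d(⊗μ_{β_k})`. [ours] -/
theorem setLIntegral_ptTaggedTarget_level {f : Fin (K + 1) × (Fin (K + 1) → Ω) → ℝ≥0∞} (hf : Measurable f)
    {A : Set (Fin (K + 1) × (Fin (K + 1) → Ω))} (hA : MeasurableSet A) :
    ∫⁻ z in A, f z ∂(ptTaggedTarget X μ β K) = ((K + 1 : ℕ) : ℝ≥0∞)⁻¹ *
      ∑ τ : Fin (K + 1), ∫⁻ x in Prod.mk τ ⁻¹' A, f (τ, x)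
        ∂(Measure.pi fun k : Fin (K + 1) => μ.tilted fun x => β k * X x) := by
  rw [← lintegral_indicator hA, lintegral_ptTaggedTarget (hf.indicator hA)]
  congr 1
  refine Finset.sum_congr rfl fun τ _ => ?_
  rw [← lintegral_indicator (measurable_prodMk_left hA)]
  exact lintegral_congr fun x => (Set.indicator_comp_right (Prod.mk τ)).symm

/-- **The tagged within-replica update is reversible for the tagged target** when `M_k` is `μ_{β_k}`-reversible
(`μ` probability, `X` bounded measurable). [ours] -/
theorem isReversible_ptReplicaUpdate [IsProbabilityMeasure μ] (hXm : Measurable X) (hXb : ∃ C, ∀ x, |X x| ≤ C)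
    (k : Fin (K + 1)) (Mk : Kernel Ω Ω) [IsMarkovKernel Mk]
    (hMk : Kernel.IsReversible Mk (μ.tilted fun x => β k * X x)) :
    Kernel.IsReversible (ptReplicaUpdate k Mk) (ptTaggedTarget X μ β K) := by
  haveI : ∀ i : Fin (K + 1), IsProbabilityMeasure (μ.tilted fun x => β i * X x) := fun i =>
    isProbabilityMeasure_tilted_mul (μ := μ) hXm hXb (β i)
  have hPi := isReversible_coordUpdateKernel k Mk (fun i : Fin (K + 1) => μ.tilted fun x => β i * X x) hMk
  intro A B hA hB
  rw [setLIntegral_ptTaggedTarget_level ((ptReplicaUpdate k Mk).measurable_coe hB) hA,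
    setLIntegral_ptTaggedTarget_level ((ptReplicaUpdate k Mk).measurable_coe hA) hB]
  congr 1
  refine Finset.sum_congr rfl fun τ _ => ?_
  simp only [ptReplicaUpdate, stWithinLevel_apply' _ _ hB, stWithinLevel_apply' _ _ hA]
  exact hPi (measurable_prodMk_left hA) (measurable_prodMk_left hB)

end Tagged

/-! ## §3 The uniform mixture of finitely many kernels -/

section Uniform

variable {E : Type*} [MeasurableSpace E] {n : ℕ}

/-- The transition measure of the uniform mixture: `(n+1)⁻¹·Σ_i κ_i(z)`. [ours] -/
def uniformMixtureMeasure (κ : Fin (n + 1) → Kernel E E) (z : E) : Measure E :=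
  ((n + 1 : ℕ) : ℝ≥0∞)⁻¹ • ∑ i : Fin (n + 1), κ i z

/-- The uniform mixture on a set. [ours] -/
theorem uniformMixtureMeasure_apply (κ : Fin (n + 1) → Kernel E E) (z : E) (s : Set E) :
    uniformMixtureMeasure κ z s = ((n + 1 : ℕ) : ℝ≥0∞)⁻¹ * ∑ i : Fin (n + 1), κ i z s := by
  simp only [uniformMixtureMeasure, Measure.smul_apply, Measure.coe_finsetSum, Finset.sum_apply, smul_eq_mul]

/-- Measurability of the uniform mixture. [ours] -/
theorem measurable_uniformMixtureMeasure (κ : Fin (n + 1) → Kernel E E) : Measurable (uniformMixtureMeasure κ) := by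
  refine Measure.measurable_of_measurable_coe _ fun s hs => ?_
  simp only [uniformMixtureMeasure_apply]
  exact measurable_const.mul (Finset.measurable_sum _ fun i _ => (κ i).measurable_coe hs)

/-- **THE UNIFORM MIXTURE KERNEL** `(n+1)⁻¹·Σ_i κ_i`: pick a component uniformly, then move by it. [ours] -/
def uniformMixtureKernel (κ : Fin (n + 1) → Kernel E E) : Kernel E E :=
  ⟨uniformMixtureMeasure κ, measurable_uniformMixtureMeasure κ⟩

/-- The uniform mixture kernel on a set. [ours] -/
theorem uniformMixtureKernel_apply' (κ : Fin (n + 1) → Kernel E E) (z : E) (s : Set E) :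
    uniformMixtureKernel κ z s = ((n + 1 : ℕ) : ℝ≥0∞)⁻¹ * ∑ i : Fin (n + 1), κ i z s :=
  uniformMixtureMeasure_apply κ z s

/-- The uniform mixture of Markov kernels is Markov. [ours] -/
instance isMarkovKernel_uniformMixtureKernel (κ : Fin (n + 1) → Kernel E E) [∀ i, IsMarkovKernel (κ i)] :
    IsMarkovKernel (uniformMixtureKernel κ) :=
  ⟨fun z => ⟨by
    rw [uniformMixtureKernel_apply']
    simp only [measure_univ, Finset.sum_const, Finset.card_univ, Fintype.card_fin, nsmul_eq_mul, mul_one]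
    exact ENNReal.inv_mul_cancel (by simp) (ENNReal.natCast_ne_top _)⟩⟩

/-- A set null for every component is null for the mixture. [ours] -/
theorem uniformMixtureKernel_null (κ : Fin (n + 1) → Kernel E E) (z : E) {s : Set E} (h : ∀ i, κ i z s = 0) :
    uniformMixtureKernel κ z s = 0 := by
  rw [uniformMixtureKernel_apply']
  simp [h]

/-- **Uniform mixtures of invariant kernels are invariant.** [folklore] -/
theorem invariant_uniformMixtureKernel (κ : Fin (n + 1) → Kernel E E) {π : Measure E}
    (h : ∀ i, Kernel.Invariant (κ i) π) : Kernel.Invariant (uniformMixtureKernel κ) π := by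
  unfold Kernel.Invariant
  ext A hA
  rw [Measure.bind_apply hA (Kernel.aemeasurable _)]
  simp only [uniformMixtureKernel_apply']
  rw [lintegral_const_mul _ (Finset.measurable_sum _ fun i _ => (κ i).measurable_coe hA),
    lintegral_finsetSum _ fun i _ => (κ i).measurable_coe hA]
  have e : ∀ i : Fin (n + 1), ∫⁻ z, κ i z A ∂π = π A := fun i => by
    rw [← Measure.bind_apply hA (Kernel.aemeasurable _)]
    exact congrFun (congrArg DFunLike.coe (h i).def) A
  simp only [e, Finset.sum_const, Finset.card_univ, Fintype.card_fin, nsmul_eq_mul]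
  rw [← mul_assoc, ENNReal.inv_mul_cancel (by simp) (ENNReal.natCast_ne_top _), one_mul]

/-- **Uniform mixtures of reversible kernels are reversible.** [folklore] -/
theorem isReversible_uniformMixtureKernel (κ : Fin (n + 1) → Kernel E E) {π : Measure E}
    (h : ∀ i, Kernel.IsReversible (κ i) π) : Kernel.IsReversible (uniformMixtureKernel κ) π := by
  intro A B hA hB
  simp only [uniformMixtureKernel_apply']
  rw [lintegral_const_mul _ (Finset.measurable_sum _ fun i _ => (κ i).measurable_coe hB),
    lintegral_const_mul _ (Finset.measurable_sum _ fun i _ => (κ i).measurable_coe hA),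
    lintegral_finsetSum _ fun i _ => (κ i).measurable_coe hB, lintegral_finsetSum _ fun i _ => (κ i).measurable_coe hA]
  congr 1
  exact Finset.sum_congr rfl fun i _ => h i hA hB

end Uniform

/-! ## §4 The random-replica update and the reversible sampler -/

section Random

variable {Ω : Type*} [MeasurableSpace Ω] {X : Ω → ℝ} {μ : Measure Ω} {β : ℕ → ℝ} {K : ℕ}

/-- **THE RANDOM-REPLICA UPDATE**: pick a replica `k` uniformly and resample it by `M_k`. [ours] -/
def ptRandomUpdate (M : Fin (K + 1) → Kernel Ω Ω) [∀ k, IsMarkovKernel (M k)] :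
    Kernel (Fin (K + 1) × (Fin (K + 1) → Ω)) (Fin (K + 1) × (Fin (K + 1) → Ω)) :=
  uniformMixtureKernel fun k => ptReplicaUpdate k (M k)

variable (M : Fin (K + 1) → Kernel Ω Ω) [∀ k, IsMarkovKernel (M k)]

/-- The random-replica update is Markov. [ours] -/
instance isMarkovKernel_ptRandomUpdate : IsMarkovKernel (ptRandomUpdate M) := by
  unfold ptRandomUpdate; infer_instance

/-- **It preserves the tag.** [ours] -/
theorem ptRandomUpdate_tagPreserving (y : Fin (K + 1) × (Fin (K + 1) → Ω)) :
    ptRandomUpdate M y {y' | ((y'.1 : Fin (K + 1)) : ℕ) ≠ ((y.1 : Fin (K + 1)) : ℕ)} = 0 :=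
  uniformMixtureKernel_null _ y fun k => ptReplicaUpdate_tagPreserving k (M k) y

/-- **It leaves the tagged target invariant** (every `M_k` leaves `μ_{β_k}` invariant). [ours] -/
theorem invariant_ptRandomUpdate [IsProbabilityMeasure μ] (hXm : Measurable X) (hXb : ∃ C, ∀ x, |X x| ≤ C)
    (hM : ∀ k : Fin (K + 1), Kernel.Invariant (M k) (μ.tilted fun x => β k * X x)) :
    Kernel.Invariant (ptRandomUpdate M) (ptTaggedTarget X μ β K) :=
  invariant_uniformMixtureKernel _ fun k => invariant_ptReplicaUpdate k (M k) hXm hXb (hM k)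

/-- **It is reversible for the tagged target** (every `M_k` `μ_{β_k}`-reversible). [ours] -/
theorem isReversible_ptRandomUpdate [IsProbabilityMeasure μ] (hXm : Measurable X) (hXb : ∃ C, ∀ x, |X x| ≤ C)
    (hM : ∀ k : Fin (K + 1), Kernel.IsReversible (M k) (μ.tilted fun x => β k * X x)) :
    Kernel.IsReversible (ptRandomUpdate M) (ptTaggedTarget X μ β K) :=
  isReversible_uniformMixtureKernel _ fun k => isReversible_ptReplicaUpdate hXm hXb k (M k) (hM k)

/-- **`τ_int` OF THE TAGGED REPLICA FOR THE FULLY CONSTRUCTED REVERSIBLE SAMPLER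
`t·ptSwapKernel + (1−t)·ptRandomUpdate M`**: uniform ladder on `[a, b]`, `a < b`, floor `0 < m ≤ Var_{μ_u}(X)`,
every `M_k` a `μ_{β_k}`-reversible Markov kernel, `K ≥ 1`, every `t`, summable tag autocorrelations with
`ρ(1) < 1`: `e·m·(b−a)²/48 − ½ ≤ τ_int(tag)`. [ours] -/
theorem ptRandom_level_tauInt_ge_kfree [IsProbabilityMeasure μ] (hXm : Measurable X) (hXb : ∃ C, ∀ x, |X x| ≤ C)
    {a b m : ℝ} (hab : a < b) (hm0 : 0 < m) (hm : ∀ u ∈ Icc a b, m ≤ variance X (μ.tilted fun x => u * X x))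
    (hK : 1 ≤ K) (t : unitInterval) (M : Fin (K + 1) → Kernel Ω Ω) [∀ k, IsMarkovKernel (M k)]
    (hM : ∀ k : Fin (K + 1), Kernel.IsReversible (M k) (μ.tilted fun x => (a + k * ((b - a) / K)) * X x))
    (hs : Summable fun n =>
      autocov (mixtureKernel t (ptSwapKernel hXm (fun k => a + k * ((b - a) / K)) K) (ptRandomUpdate M))
        (ptTaggedTarget X μ (fun k => a + k * ((b - a) / K)) K) (fun z => (((z.1 : Fin (K + 1)) : ℕ) : ℝ) - K / 2)
        (n + 1) /
      autocov (mixtureKernel t (ptSwapKernel hXm (fun k => a + k * ((b - a) / K)) K) (ptRandomUpdate M))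
        (ptTaggedTarget X μ (fun k => a + k * ((b - a) / K)) K) (fun z => (((z.1 : Fin (K + 1)) : ℕ) : ℝ) - K / 2) 0)
    (hρ : autocov (mixtureKernel t (ptSwapKernel hXm (fun k => a + k * ((b - a) / K)) K) (ptRandomUpdate M))
        (ptTaggedTarget X μ (fun k => a + k * ((b - a) / K)) K) (fun z => (((z.1 : Fin (K + 1)) : ℕ) : ℝ) - K / 2) 1 /
      autocov (mixtureKernel t (ptSwapKernel hXm (fun k => a + k * ((b - a) / K)) K) (ptRandomUpdate M))
        (ptTaggedTarget X μ (fun k => a + k * ((b - a) / K)) K) (fun z => (((z.1 : Fin (K + 1)) : ℕ) : ℝ) - K / 2) 0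
        < 1) :
    Real.exp 1 * m * (b - a) ^ 2 / 48 - 1 / 2 ≤
      tauInt (fun n =>
        autocov (mixtureKernel t (ptSwapKernel hXm (fun k => a + k * ((b - a) / K)) K) (ptRandomUpdate M))
          (ptTaggedTarget X μ (fun k => a + k * ((b - a) / K)) K) (fun z => (((z.1 : Fin (K + 1)) : ℕ) : ℝ) - K / 2)
          n /
        autocov (mixtureKernel t (ptSwapKernel hXm (fun k => a + k * ((b - a) / K)) K) (ptRandomUpdate M))
          (ptTaggedTarget X μ (fun k => a + k * ((b - a) / K)) K) (fun z => (((z.1 : Fin (K + 1)) : ℕ) : ℝ) - K / 2)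
          0) :=
  ptMix_level_tauInt_ge_kfree hXm hXb hab hm0 hm hK t (ptRandomUpdate M)
    (isReversible_ptRandomUpdate (β := fun k => a + k * ((b - a) / K)) M hXm hXb hM)
    (ptRandomUpdate_tagPreserving M) hs hρ

end Random

end Summit.Ventures.LatticeQCDFlow.Scaling

end
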